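import Mathlib.RingTheory.MvPolynomial.WeightedHomogeneous
import Mathlib.RingTheory.FiniteType
import Mathlib.RingTheory.RegularLocalRing.Polynomial
import Mathlib.Algebra.Order.Antidiag.Finsupp
import Mathlib.Algebra.BigOperators.Fin
import Literature.AlgebraicGeometry.Resolution.AffineBlowupAlgebra
import Literature.AlgebraicGeometry.Resolution.AffineBlowup
import HarnessLib

/-!
# Bipartite splitting of balanced exponent vectors

Support file for crux stmt-ResolutionOfSingularities-15317 (`FrobeniusLadder.FRationalResolution`), line `redirect`,
lead c5, CONE PROGRAMME (rung 4′ in all dimensions on the Veronese cones `V(n,r) = Spec k[χᵈ : |d| = r]`,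
and on the Segre cones `Spec k[xᵢyⱼ]`).
We prove the combinatorial splitting fact behind "a monomial of `k[x₁..x_a, y₁..y_b]` whose `x`-degree and
`y`-degree both equal `s` is a product of `s` Segre generators `xᵢyⱼ`": an exponent vector
`d : Fin a ⊕ Fin b →₀ ℕ` whose two block sums both equal `s` is a sum of `s` vectors
`single (inl i) 1 + single (inr j) 1`. [folklore]
-/

-- single-problem summit: the doubled namespace component is forced
set_option linter.dupNamespace false

noncomputable section

namespace Summit.ResolutionOfSingularities.ResolutionOfSingularities.Theorems.FRationalResolution

section Cones

/-- Block sums of an elementary bipartite vector `single (inl i) 1 + single (inr j) 1 + d'` over the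
`x`-block: the first summand contributes `1`, the second `0`. -/
private theorem bipartiteSplit_sum_inl {a b : ℕ} (i : Fin a) (j : Fin b) (d' : Fin a ⊕ Fin b →₀ ℕ) :
    ∑ x : Fin a, (Finsupp.single (Sum.inl i) 1 + Finsupp.single (Sum.inr j) 1 + d' : Fin a ⊕ Fin b →₀ ℕ)
        (Sum.inl x) = ∑ x : Fin a, d' (Sum.inl x) + 1 := by
  simp only [Finsupp.coe_add, Pi.add_apply, Finsupp.single_apply, Sum.inl.injEq, reduceCtorEq,
    add_zero, Finset.sum_add_distrib, Finset.sum_ite_eq, Finset.mem_univ, ↓reduceIte]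
  omega

/-- Block sums of an elementary bipartite vector `single (inl i) 1 + single (inr j) 1 + d'` over the
`y`-block: the first summand contributes `0`, the second `1`. -/
private theorem bipartiteSplit_sum_inr {a b : ℕ} (i : Fin a) (j : Fin b) (d' : Fin a ⊕ Fin b →₀ ℕ) :
    ∑ y : Fin b, (Finsupp.single (Sum.inl i) 1 + Finsupp.single (Sum.inr j) 1 + d' : Fin a ⊕ Fin b →₀ ℕ)
        (Sum.inr y) = ∑ y : Fin b, d' (Sum.inr y) + 1 := by
  simp only [Finsupp.coe_add, Pi.add_apply, Finsupp.single_apply, Sum.inr.injEq, reduceCtorEq,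
    zero_add, Finset.sum_add_distrib, Finset.sum_ite_eq, Finset.mem_univ, ↓reduceIte]
  omega

/-- **Bipartite splitting of exponent vectors.** An exponent vector `d` on `Fin a ⊕ Fin b` whose two
block sums `∑ᵢ d (inl i)` and `∑ⱼ d (inr j)` both equal `s` is a sum of `s` elementary vectors
`single (inl i) 1 + single (inr j) 1`.

Proof: induction on `s`, generalizing `d`. For `s = 0` every value of `d` is bounded by its block sum
(`Finset.single_le_sum`), hence vanishes, and the empty family works. For `s + 1` both block sums are
positive, so there are `i`, `j` with `d (inl i) ≠ 0 ≠ d (inr j)` (`Finset.exists_ne_zero_of_sum_ne_zero`);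
then `single (inl i) 1 + single (inr j) 1 ≤ d`, and writing `d = single (inl i) 1 + single (inr j) 1 + d'`
the block sums of `d'` are `s`; split `d'` by induction and prepend `(i, j)` with `Fin.cons`
(`Fin.sum_univ_succ`). [folklore] -/
theorem stub_finsupp_bipartite_split {a b : ℕ} (s : ℕ) (d : Fin a ⊕ Fin b →₀ ℕ)
    (h₁ : ∑ i : Fin a, d (Sum.inl i) = s) (h₂ : ∑ j : Fin b, d (Sum.inr j) = s) :
    ∃ e : Fin s → Fin a × Fin b,
      d = ∑ l, (Finsupp.single (Sum.inl (e l).1) 1 + Finsupp.single (Sum.inr (e l).2) 1) := by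
  induction s generalizing d with
  | zero =>
    refine ⟨Fin.elim0, ?_⟩
    rw [Finset.univ_eq_empty, Finset.sum_empty]
    ext x
    rcases x with i | j
    · have hi := Finset.single_le_sum (f := fun i : Fin a => d (Sum.inl i)) (fun i _ => Nat.zero_le _)
        (Finset.mem_univ i)
      rw [h₁] at hi
      exact Nat.le_zero.mp hi
    · have hj := Finset.single_le_sum (f := fun j : Fin b => d (Sum.inr j)) (fun j _ => Nat.zero_le _)
        (Finset.mem_univ j)
      rw [h₂] at hj
      exact Nat.le_zero.mp hj
  | succ s ih =>
    obtain ⟨i, -, hi⟩ := Finset.exists_ne_zero_of_sum_ne_zero (h₁.trans_ne (Nat.succ_ne_zero s))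
    obtain ⟨j, -, hj⟩ := Finset.exists_ne_zero_of_sum_ne_zero (h₂.trans_ne (Nat.succ_ne_zero s))
    have hle : Finsupp.single (Sum.inl i) 1 + Finsupp.single (Sum.inr j) 1 ≤ d := by
      rw [Finsupp.le_def]
      intro x
      simp only [Finsupp.coe_add, Pi.add_apply, Finsupp.single_apply]
      split_ifs with hx hy hy
      · exact absurd (hx.trans hy.symm) Sum.inl_ne_inr
      · subst hx; omega
      · subst hy; omega
      · exact Nat.zero_le _
    obtain ⟨d', rfl⟩ := le_iff_exists_add.mp hle
    have h₁' : ∑ x : Fin a, d' (Sum.inl x) = s := by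
      rw [bipartiteSplit_sum_inl] at h₁
      omega
    have h₂' : ∑ y : Fin b, d' (Sum.inr y) = s := by
      rw [bipartiteSplit_sum_inr] at h₂
      omega
    obtain ⟨e', he'⟩ := ih d' h₁' h₂'
    refine ⟨Fin.cons (i, j) e', ?_⟩
    rw [Fin.sum_univ_succ]
    simp only [Fin.cons_zero, Fin.cons_succ]
    rw [← he']

end Cones

end Summit.ResolutionOfSingularities.ResolutionOfSingularities.Theorems.FRationalResolution

end
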